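import Summits.HubbardSuperconductivity.HubbardSuperconductivity.Theorems.ThermalWedgeTwSeededEnsembleEquivalenceBracketOfDifferentiableLimit
import Summits.HubbardSuperconductivity.HubbardSuperconductivity.Theorems.ThermalWedgeTwSeededEnsembleEquivalenceSeededLimitOfSourcedLimit

/-!
# Crux `TwSeededEnsembleEquivalence` (stmt-HubbardSuperconductivity-1698), thermal line — the secant
# bracket of the seeded pressure from the SOURCED infinite-volume pressure (composition)

Support file (`--supports stmt-HubbardSuperconductivity-1698`; no definition, nothing assumed). Composition of
`tw_seededPressureLimit_of_sourcedLimit` (`…SeededLimitOfSourcedLimit.lean`) with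
`tw_seededSecantBracket_of_differentiableLimit` (`…BracketOfDifferentiableLimit.lean`): the hypothesis `hBr`
of the line's closer `stub_thermalCloser` at an `L`-independent `μ₀` of the window follows from the
approximating-Hamiltonian theorem (item 1703, hypothesis `hAHM` = the verbatim body of `TwApproximatingHamiltonian`,
discharged by `twApproximatingHamiltonian_proof`) and three statements about the SHORT-RANGE SOURCED torus only:
(TDL~) `p̃_L(β,μ,h) → q(μ,h)` on `[μ₁,μ₂] × [−(13g+1), 13g+1]`; (DIFF) `μ ↦ b(μ) := sup_{|h| ≤ 13g+1} [q(μ,h) − h²/g]`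
differentiable on `(μ₁,μ₂)`; (EDGE) `b′(μ⁻) ≤ 1 − δ ≤ b′(μ⁺)` at two interior points. Also recorded here:
pointwise limits of convex functions are convex (`bdl_convexOn_of_limit`) and the edge-SECANT forms
`bdl_bracket_of_differentiableLimit_secant`, `tw_seededSecantBracket_of_differentiableLimit_secant` ((EDGE) as two
secants of `b` bracketing `1 − δ`, via convexity of the seeded pressure `bdl_convexOn_seededPressure`). [folklore]
-/

set_option linter.dupNamespace false

namespace Summit.HubbardSuperconductivity.HubbardSuperconductivity.Theorems.TwSeededEnsembleEquivalence.ThermalDuality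

open Matrix Filter Topology Finset Literature.MathematicalPhysics.QuantumLattice
open scoped ComplexOrder Matrix.Norms.L2Operator

noncomputable section

/-! ### Convexity of limits and the edge-secant form -/

/-- **Pointwise limits of convex functions are convex** (on a convex set on which the convergence
holds; `ε`-`L₀` form of the limit). [folklore] -/
theorem bdl_convexOn_of_limit {S : Set ℝ} (hS : Convex ℝ S) (f : ℕ → ℝ → ℝ) (b : ℝ → ℝ)
    (hf : ∀ L, ConvexOn ℝ S (f L))
    (hlim : ∀ μ ∈ S, ∀ κ : ℝ, 0 < κ → ∃ L₀ : ℕ, ∀ L, L₀ ≤ L → |f L μ - b μ| ≤ κ) :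
    ConvexOn ℝ S b := by
  refine ⟨hS, fun x hx y hy a c ha hc hac => ?_⟩
  have hz : a • x + c • y ∈ S := hS hx hy ha hc hac
  refine le_of_forall_pos_le_add fun κ hκ => ?_
  obtain ⟨L₁, h1⟩ := hlim _ hz (κ / 3) (by positivity)
  obtain ⟨L₂, h2⟩ := hlim x hx (κ / 3) (by positivity)
  obtain ⟨L₃, h3⟩ := hlim y hy (κ / 3) (by positivity)
  have e1 := h1 (max L₁ (max L₂ L₃)) (le_max_left _ _)
  have e2 := h2 (max L₁ (max L₂ L₃)) ((le_max_left _ _).trans (le_max_right _ _))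
  have e3 := h3 (max L₁ (max L₂ L₃)) ((le_max_right _ _).trans (le_max_right _ _))
  have hconv := (hf (max L₁ (max L₂ L₃))).2 hx hy ha hc hac
  simp only [smul_eq_mul] at hconv e1 hz ⊢
  rw [abs_le] at e1 e2 e3
  have i2 : a * f (max L₁ (max L₂ L₃)) x ≤ a * (b x + κ / 3) :=
    mul_le_mul_of_nonneg_left (by linarith [e2.2]) ha
  have i3 : c * f (max L₁ (max L₂ L₃)) y ≤ c * (b y + κ / 3) :=
    mul_le_mul_of_nonneg_left (by linarith [e3.2]) hc
  have : a * (κ / 3) + c * (κ / 3) = κ / 3 := by rw [← add_mul, hac, one_mul]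
  nlinarith [e1.1, i2, i3, this]


/-- **Secant bracket from a differentiable limit, edge SECANT form** (model-free). As
`bdl_bracket_of_differentiableLimit`, with the slope conditions at `μ⁻, μ⁺` replaced by secant
conditions `(b(μ⁻+s) − b(μ⁻))/s ≤ d ≤ (b(μ⁺) − b(μ⁺−s))/s`, for CONVEX `f_L` (then `b` is convex and
`b′(μ⁻) ≤` right secant, left secant `≤ b′(μ⁺)`). [folklore] -/
theorem bdl_bracket_of_differentiableLimit_secant (f : ℕ → ℝ → ℝ) (b : ℝ → ℝ)
    (μ₁ μ₂ d μm μp s : ℝ) (hs : 0 < s)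
    (hconv : ∀ L, ConvexOn ℝ (Set.Icc μ₁ μ₂) (f L))
    (hlim : ∀ μ ∈ Set.Icc μ₁ μ₂, ∀ κ : ℝ, 0 < κ → ∃ L₀ : ℕ, ∀ L, L₀ ≤ L → |f L μ - b μ| ≤ κ)
    (hdiff : ∀ μ ∈ Set.Ioo μ₁ μ₂, DifferentiableAt ℝ b μ)
    (hm : μ₁ < μm) (hms : μm + s ≤ μ₂) (hps : μ₁ ≤ μp - s) (hp : μp < μ₂)
    (hdm : (b (μm + s) - b μm) / s ≤ d) (hdp : d ≤ (b μp - b (μp - s)) / s) :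
    ∃ μ₀ ∈ Set.uIcc μm μp, μ₀ ∈ Set.Ioo μ₁ μ₂ ∧ HasDerivAt b d μ₀ ∧
      ∀ η : ℝ, 0 < η → ∃ τ : ℝ, 0 < τ ∧ ∃ L₀ : ℕ, ∀ L, L₀ ≤ L →
        (f L (μ₀ + τ) - f L μ₀) / τ ≤ d + η ∧ d - η ≤ (f L μ₀ - f L (μ₀ - τ)) / τ := by
  have hb : ConvexOn ℝ (Set.Icc μ₁ μ₂) b := bdl_convexOn_of_limit (convex_Icc μ₁ μ₂) f b hconv hlim
  have hmI : μm ∈ Set.Ioo μ₁ μ₂ := ⟨hm, by linarith⟩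
  have hpI : μp ∈ Set.Ioo μ₁ μ₂ := ⟨by linarith, hp⟩
  have h1 : deriv b μm ≤ d := by
    have := hb.deriv_le_slope (x := μm) (y := μm + s) ⟨hm.le, by linarith⟩ ⟨by linarith, hms⟩
      (by linarith) (hdiff μm hmI)
    rw [slope_def_field, add_sub_cancel_left] at this
    exact this.trans hdm
  have h2 : d ≤ deriv b μp := by
    have := hb.slope_le_deriv (x := μp - s) (y := μp) ⟨hps, by linarith⟩ ⟨by linarith, hp.le⟩
      (by linarith) (hdiff μp hpI)
    rw [slope_def_field, sub_sub_cancel] at this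
    exact hdp.trans this
  exact bdl_bracket_of_differentiableLimit f b μ₁ μ₂ d μm μp hlim hdiff hmI hpI h1 h2


/-- **The same, edge SECANT form**: (EDGE) replaced by two secant conditions on the limit `b`,
`(b(μ⁻+s) − b(μ⁻))/s ≤ 1 − δ ≤ (b(μ⁺) − b(μ⁺−s))/s` with `[μ⁻, μ⁻+s], [μ⁺−s, μ⁺] ⊂ [μ₁, μ₂]`,
`μ₁ < μ⁻`, `μ⁺ < μ₂` — the finite-volume pressures being convex in `μ` (`bdl_convexOn_seededPressure`),
so is their limit `b`, and its slopes at `μ∓` are bracketed by these secants. [folklore] -/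
theorem tw_seededSecantBracket_of_differentiableLimit_secant (δ U g β μ₁ μ₂ μm μp s : ℝ) (b : ℝ → ℝ)
    (hβ : 0 < β) (hs : 0 < s)
    (hlim : ∀ μ ∈ Set.Icc μ₁ μ₂, ∀ κ : ℝ, 0 < κ → ∃ L₀ : ℕ, ∀ (L : ℕ) [NeZero L], L₀ ≤ L →
      |Real.log (Matrix.partitionFn β (hubbardTorusWith 2 L 1 U μ - ((g / (L : ℝ) ^ 2 : ℝ) : ℂ) •
          ((pairField dWaveFormFactor L)ᴴ * pairField dWaveFormFactor L))).re / (β * (L : ℝ) ^ 2) -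
        b μ| ≤ κ)
    (hdiff : ∀ μ ∈ Set.Ioo μ₁ μ₂, DifferentiableAt ℝ b μ)
    (hm : μ₁ < μm) (hms : μm + s ≤ μ₂) (hps : μ₁ ≤ μp - s) (hp : μp < μ₂)
    (hdm : (b (μm + s) - b μm) / s ≤ 1 - δ) (hdp : 1 - δ ≤ (b μp - b (μp - s)) / s) :
    ∃ μ₀ ∈ Set.Icc μ₁ μ₂, μ₀ ∈ Set.uIcc μm μp ∧ HasDerivAt b (1 - δ) μ₀ ∧
      ∀ η : ℝ, 0 < η → ∃ τ : ℝ, 0 < τ ∧ ∃ L₀ : ℕ, ∀ (L : ℕ) [NeZero L], L₀ ≤ L →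
        ((Real.log (Matrix.partitionFn β (hubbardTorusWith 2 L 1 U (μ₀ + τ) - ((g / (L : ℝ) ^ 2 : ℝ) : ℂ) •
            ((pairField dWaveFormFactor L)ᴴ * pairField dWaveFormFactor L))).re / (β * (L : ℝ) ^ 2)) -
          (Real.log (Matrix.partitionFn β (hubbardTorusWith 2 L 1 U μ₀ - ((g / (L : ℝ) ^ 2 : ℝ) : ℂ) •
            ((pairField dWaveFormFactor L)ᴴ * pairField dWaveFormFactor L))).re / (β * (L : ℝ) ^ 2))) / τ ≤
          (1 - δ) + η ∧
        (1 - δ) - η ≤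
        ((Real.log (Matrix.partitionFn β (hubbardTorusWith 2 L 1 U μ₀ - ((g / (L : ℝ) ^ 2 : ℝ) : ℂ) •
            ((pairField dWaveFormFactor L)ᴴ * pairField dWaveFormFactor L))).re / (β * (L : ℝ) ^ 2)) -
          (Real.log (Matrix.partitionFn β (hubbardTorusWith 2 L 1 U (μ₀ - τ) - ((g / (L : ℝ) ^ 2 : ℝ) : ℂ) •
            ((pairField dWaveFormFactor L)ᴴ * pairField dWaveFormFactor L))).re / (β * (L : ℝ) ^ 2))) / τ := by
  set f : ℕ → ℝ → ℝ := fun L μ =>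
    Real.log (Matrix.partitionFn β (hubbardTorusWith 2 (L + 1) 1 U μ - ((g / ((L + 1 : ℕ) : ℝ) ^ 2 : ℝ) : ℂ) •
      ((pairField dWaveFormFactor (L + 1))ᴴ * pairField dWaveFormFactor (L + 1)))).re /
        (β * ((L + 1 : ℕ) : ℝ) ^ 2) with hf
  have hconv : ∀ L, ConvexOn ℝ (Set.Icc μ₁ μ₂) (f L) := fun L =>
    bdl_convexOn_seededPressure (L + 1) U g β hβ (convex_Icc μ₁ μ₂)
  have hlim' : ∀ μ ∈ Set.Icc μ₁ μ₂, ∀ κ : ℝ, 0 < κ → ∃ L₀ : ℕ, ∀ L, L₀ ≤ L → |f L μ - b μ| ≤ κ := by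
    intro μ hμ κ hκ
    obtain ⟨L₀, hL₀⟩ := hlim μ hμ κ hκ
    exact ⟨L₀, fun L hL => hL₀ (L + 1) (by omega)⟩
  obtain ⟨μ₀, hμ₀, hμ₀I, hder, hbr⟩ := bdl_bracket_of_differentiableLimit_secant f b μ₁ μ₂ (1 - δ) μm μp s
    hs hconv hlim' hdiff hm hms hps hp hdm hdp
  refine ⟨μ₀, ⟨hμ₀I.1.le, hμ₀I.2.le⟩, hμ₀, hder, fun η hη => ?_⟩
  obtain ⟨τ, hτ, L₀, hL₀⟩ := hbr η hη
  refine ⟨τ, hτ, L₀ + 1, fun L _ hL => ?_⟩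
  obtain ⟨k, rfl⟩ := Nat.exists_eq_add_one_of_ne_zero (NeZero.ne L)
  exact hL₀ k (by omega)

/-! ### Composition with the sourced limit -/

/-- **THERMAL SECANT BRACKET OF THE SEEDED PRESSURE FROM THE SOURCED INFINITE-VOLUME PRESSURE.** Fix
`δ, U`, `g, β > 0`, a window `μ₁ < μ₂` and the sourced limit `q : ℝ → ℝ → ℝ`; write
`b(μ) = sup_{|h| ≤ 13g+1} [q(μ,h) − h²/g]`. Assume the AHM theorem (`hAHM`, verbatim body of item 1703), the
thermodynamic limit of the sourced pressure on `[μ₁,μ₂] × [−(13g+1), 13g+1]` (`hsl`), differentiability of `b` on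
`(μ₁,μ₂)` (`hdiff`) and the slope conditions `b′(μ⁻) ≤ 1 − δ ≤ b′(μ⁺)` at interior points. Then at some
`L`-independent `μ₀ ∈ [μ₁, μ₂]` the two-sided secant bracket of the finite-volume SEEDED pressure holds (the
hypothesis `hBr` of `stub_thermalCloser`). [folklore] -/
theorem tw_seededSecantBracket_of_sourcedLimit :
    ∀ (δ U g β μ₁ μ₂ μm μp : ℝ) (q : ℝ → ℝ → ℝ), 0 < β → 0 < g → (∀ (U μ β g : ℝ), 0 < β → 0 < g → (∀ (L : ℕ) [NeZero L] (h : ℝ), (Real.log (Matrix.partitionFn β (Literature.MathematicalPhysics.QuantumLattice.dWaveSourceTorus L U μ h)).re / (β * (L : ℝ) ^ 2)) - h ^ 2 / g ≤ (Real.log (Matrix.partitionFn β (Literature.MathematicalPhysics.QuantumLattice.hubbardTorusWith 2 L 1 U μ - ((g / (L : ℝ) ^ 2 : ℝ) : ℂ) • ((Literature.MathematicalPhysics.QuantumLattice.pairField Literature.MathematicalPhysics.QuantumLattice.dWaveFormFactor L)ᴴ * Literature.MathematicalPhysics.QuantumLattice.pairField Literature.MathematicalPhysics.QuantumLattice.dWaveFormFactor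 L))).re / (β * (L : ℝ) ^ 2))) ∧ (∀ ε : ℝ, 0 < ε → ∃ L₀ : ℕ, ∀ (L : ℕ) [NeZero L], L₀ ≤ L → ∃ h : ℝ, (Real.log (Matrix.partitionFn β (Literature.MathematicalPhysics.QuantumLattice.hubbardTorusWith 2 L 1 U μ - ((g / (L : ℝ) ^ 2 : ℝ) : ℂ) • ((Literature.MathematicalPhysics.QuantumLattice.pairField Literature.MathematicalPhysics.QuantumLattice.dWaveFormFactor L)ᴴ * Literature.MathematicalPhysics.QuantumLattice.pairField Literature.MathematicalPhysics.QuantumLattice.dWaveFormFactor L))).re / (β * (L : ℝ) ^ 2)) ≤ (Real.log (Matrix.partitionFn β (Literature.MathematicalPhysics.QuantumLattice.dWaveSourceTorus L U μ h)).re / (β * (L : ℝ) ^ 2)) - h ^ 2 / g + ε)) → (∀ μ ∈ Set.Icc μ₁ μ₂, ∀ h ∈ Set.Icc (-(13 * g + 1)) (13 * g + 1), ∀ κ : ℝ, 0 < κ → ∃ L₀ : ℕ, ∀ (L : ℕ) [NeZero L], L₀ ≤ L → |Real.log (Matrix.partitionFn β (Literature.MathematicalPhysics.QuantumLattice.dWaveSourceTorus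 L U μ h)).re / (β * (L : ℝ) ^ 2) - q μ h| ≤ κ) → (∀ μ ∈ Set.Ioo μ₁ μ₂, DifferentiableAt ℝ (fun μ' : ℝ => sSup ((fun h : ℝ => q μ' h - h ^ 2 / g) '' Set.Icc (-(13 * g + 1)) (13 * g + 1))) μ) → μm ∈ Set.Ioo μ₁ μ₂ → μp ∈ Set.Ioo μ₁ μ₂ → deriv (fun μ' : ℝ => sSup ((fun h : ℝ => q μ' h - h ^ 2 / g) '' Set.Icc (-(13 * g + 1)) (13 * g + 1))) μm ≤ 1 - δ → 1 - δ ≤ deriv (fun μ' : ℝ => sSup ((fun h : ℝ => q μ' h - h ^ 2 / g) '' Set.Icc (-(13 * g + 1)) (13 * g + 1))) μp → ∃ μ₀ ∈ Set.Icc μ₁ μ₂, μ₀ ∈ Set.uIcc μm μp ∧ ∀ η : ℝ, 0 < η → ∃ τ : ℝ, 0 < τ ∧ ∃ L₀ : ℕ, ∀ (L : ℕ) [NeZero L], L₀ ≤ L → ((Real.log (Matrix.partitionFn β (Literature.MathematicalPhysics.QuantumLattice.hubbardTorusWith 2 L 1 U (μ₀ + τ) - ((g / (L : ℝ) ^ 2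 : ℝ) : ℂ) • ((Literature.MathematicalPhysics.QuantumLattice.pairField Literature.MathematicalPhysics.QuantumLattice.dWaveFormFactor L)ᴴ * Literature.MathematicalPhysics.QuantumLattice.pairField Literature.MathematicalPhysics.QuantumLattice.dWaveFormFactor L))).re / (β * (L : ℝ) ^ 2)) - (Real.log (Matrix.partitionFn β (Literature.MathematicalPhysics.QuantumLattice.hubbardTorusWith 2 L 1 U μ₀ - ((g / (L : ℝ) ^ 2 : ℝ) : ℂ) • ((Literature.MathematicalPhysics.QuantumLattice.pairField Literature.MathematicalPhysics.QuantumLattice.dWaveFormFactor L)ᴴ * Literature.MathematicalPhysics.QuantumLattice.pairField Literature.MathematicalPhysics.QuantumLattice.dWaveFormFactor L))).re / (β * (L : ℝ) ^ 2))) / τ ≤ (1 - δ) + η ∧ (1 - δ) - η ≤ ((Real.log (Matrix.partitionFn β (Literature.MathematicalPhysics.QuantumLattice.hubbardTorusWith 2 L 1 U μ₀ - ((g / (L : ℝ) ^ 2 : ℝ) : ℂ) • ((Literature.MathematicalPhysics.QuantumLattice.pairField Literature.MathematicalPhysics.QuantumLattice.dWaveFormFactor L)ᴴ * Literature.MathematicalPhysics.QuantumLattice.pairField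 Literature.MathematicalPhysics.QuantumLattice.dWaveFormFactor L))).re / (β * (L : ℝ) ^ 2)) - (Real.log (Matrix.partitionFn β (Literature.MathematicalPhysics.QuantumLattice.hubbardTorusWith 2 L 1 U (μ₀ - τ) - ((g / (L : ℝ) ^ 2 : ℝ) : ℂ) • ((Literature.MathematicalPhysics.QuantumLattice.pairField Literature.MathematicalPhysics.QuantumLattice.dWaveFormFactor L)ᴴ * Literature.MathematicalPhysics.QuantumLattice.pairField Literature.MathematicalPhysics.QuantumLattice.dWaveFormFactor L))).re / (β * (L : ℝ) ^ 2))) / τ := by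
  intro δ U g β μ₁ μ₂ μm μp q hβ hg hAHM hsl hdiff hm hp hdm hdp
  have hlim : ∀ μ ∈ Set.Icc μ₁ μ₂, ∀ κ : ℝ, 0 < κ → ∃ L₀ : ℕ, ∀ (L : ℕ) [NeZero L], L₀ ≤ L →
      |Real.log (Matrix.partitionFn β (hubbardTorusWith 2 L 1 U μ - ((g / (L : ℝ) ^ 2 : ℝ) : ℂ) •
          ((pairField dWaveFormFactor L)ᴴ * pairField dWaveFormFactor L))).re / (β * (L : ℝ) ^ 2) -
        sSup ((fun h : ℝ => q μ h - h ^ 2 / g) '' Set.Icc (-(13 * g + 1)) (13 * g + 1))| ≤ κ :=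
    fun μ hμ => tw_seededPressureLimit_of_sourcedLimit U g β μ (q μ) hβ hg (hAHM U μ β g hβ hg) (hsl μ hμ)
  obtain ⟨μ₀, hμ₀, hμ₀', -, hbr⟩ := tw_seededSecantBracket_of_differentiableLimit δ U g β μ₁ μ₂ μm μp
    (fun μ' : ℝ => sSup ((fun h : ℝ => q μ' h - h ^ 2 / g) '' Set.Icc (-(13 * g + 1)) (13 * g + 1)))
    hlim hdiff hm hp hdm hdp
  exact ⟨μ₀, hμ₀, hμ₀', hbr⟩

end

end Summit.HubbardSuperconductivity.HubbardSuperconductivity.Theorems.TwSeededEnsembleEquivalence.ThermalDuality
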